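import Summits.BirchSwinnertonDyer.Rank1Residual.X11b.RouteR1Coinvariants
import Summits.BirchSwinnertonDyer.Rank1Residual.X11b.RouteR1BaseSelmerCount
import Summits.BirchSwinnertonDyer.Rank1Residual.X11b.AnticyclotomicRestrictionInjective
import Summits.BirchSwinnertonDyer.Rank1Residual.X11b.LocalTorsionMultiplicative
import HarnessLib

/-!
# Class X2 at a NON-SPLIT multiplicative prime: the Poitou–Tate atoms (P9), (L10) of the anticyclotomic
# control theorem and the bijectivity of the `Σ(N⁺)`-relaxed control map WITHOUT irreducibility
# (cell `bsd-eis`, seat `bsd-eis-cgshw`; TARGET §6.2 CTL port, brick 3)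

HONEST FRAMING (cell `bsd-eis`): theorems only; nothing booked; X2 stays CONSTRUCTION-SHAPED. The X11b
route-R1 control chain (`X11b/RouteR1Coinvariants.lean`, `RouteR1LocSurj.lean`,
`AnticyclotomicControlAtoms.lean`) consumes the erratum's A′-hypotheses (`5 ≤ p`, `Mult`, `Irr`, (iv)
`E(ℚ_p)[p] = 0`) through exactly two local/global torsion statements: `E(K̄)[p^∞]^{D_𝔭 ⊓ ker κ} = 0`
(`ErratumHypotheses.fixedPoints_decomp_inf_kerSubgroup_eq_bot`, from (iv)) and `E(K_∞)[p^∞] = 0`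
(from `Irr ∧ Ram`). At an odd NON-SPLIT multiplicative `p` BOTH hold for every `E` (any image of
`E[p]`) because `E(ℚ_p)[p] = 0` (`X11b.LocalTorsion.localTorsion_eq_zero_of_nonsplit`). This file
re-derives, with `(3 ≤ p, Mult, ¬Split)` in place of `ErratumHypotheses` and `(K imaginary quadratic,
p split in K)` in place of `IsErratumField`, verbatim otherwise: the local no-invariants statements,
the bijectivity of `s^{Σ(N⁺)}` (JSW17 §3.3), atom (L10) `CoinvariantsTrivialAt` (JSW17 Lemma 3.3.3) and
atom (P9) `LocSurjAt` (JSW17 Prop. 3.3.2), plus `rank E(K) = 1 ∧ #Ш(E/K) < ∞` for a CGLS field.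
CONDITIONAL on the cited cohomological facts exactly as the source theorems.

References: [JetchevSkinnerWan2017] §3.3, Prop. 3.3.2, Lemma 3.3.3; [Castella2018] Thm. 2.3;
[GreenbergLNM1716] §3; [SilvermanAEC2009] VII.6.1.
-/

set_option autoImplicit false

noncomputable section

open scoped Classical

open WeierstrassCurve NumberField IsDedekindDomain Field
open Literature.NumberTheory.EllipticCurves Literature.NumberTheory.EllipticCurves.GreenbergSelmer
  Literature.NumberTheory.EllipticCurves.ModularForms
  Literature.NumberTheory.EllipticCurves.Rank1Residual
  Literature.NumberTheory.EllipticCurves.Rank1Residual.Typed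
  Literature.NumberTheory.GaloisRepresentations Literature.NumberTheory.GaloisCohomology
  Literature.NumberTheory.Automorphic
  Summit.BirchSwinnertonDyer.Rank1Residual.X11b.AcSelmer
  Summit.BirchSwinnertonDyer.Rank1Residual.X11b.LocBridge
  Summit.BirchSwinnertonDyer.Rank1Residual.X11b

namespace Summit.BirchSwinnertonDyer.Rank1Residual.X2

variable (W : WeierstrassCurve ℚ) [W.IsElliptic] [W.IsGloballyMinimal] (p : ℕ) [Fact p.Prime]

/-! ### Local and global no-invariants at a non-split prime -/

/-- **`E(K̄)[p^∞]^{D_𝔭 ⊓ ker κ} = 0` at every degree-one `𝔭 ∣ p` of every number field, every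
`ℤ_p`-extension, when `p ≥ 3` is NON-SPLIT multiplicative** (the X2 twin of
`X11b.ErratumHypotheses.fixedPoints_decomp_inf_kerSubgroup_eq_bot`: its input (iv) `E(ℚ_p)[p] = 0` is
`X11b.LocalTorsion.localTorsion_eq_zero_of_nonsplit`). [cite: SilvermanAEC2009, Thm VII.6.1 and Exercise 3.5]
[cite: Castella2018Erratum, Lemma 2.1 (pp. 1–2)] -/
theorem fixedPoints_decomp_inf_kerSubgroup_eq_bot_of_not_split (hp3 : 3 ≤ p) (hmult : Mult W p)
    (hns : ¬ W.HasSplitMultiplicativeReductionAtPrime p)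
    (K : Type) [Field K] [NumberField K] (κ : ZpExtension K p) (𝔭 : HeightOneSpectrum (𝓞 K))
    (h𝔭 : ((p : ℕ) : 𝓞 K) ∈ 𝔭.asIdeal) (he : 𝔭.asIdeal.ramificationIdx (𝓞 ℚ) = 1)
    (hf : 𝔭.asIdeal.inertiaDeg (𝓞 ℚ) = 1) :
    FixedPoints.addSubgroup ↥(decomp 𝔭 ⊓ κ.kerSubgroup) ((W.baseChange K).geomPrimaryTorsion p) = ⊥ := by
  obtain ⟨e⟩ := exists_ringHom_adicCompletion_padic_of_degreeOne p 𝔭 h𝔭 he hf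
  have hKv := noPTorsion_baseChange_adicCompletion_of_padic W p 𝔭 e
    (LocalTorsion.localTorsion_eq_zero_of_nonsplit W p hp3 hmult hns)
  exact fixedPoints_decomp_inf_kerSubgroup_eq_bot κ (W.baseChange K) 𝔭 fun m hfix hpm ↦
    eq_zero_of_fixed_decomp_of_local (W.baseChange K) p 𝔭 hKv m hfix hpm

/-- `E(K̄)[p^∞]` has no `Γ_{K_𝔭}`-invariant point (X2 twin of `X11b.ErratumHypotheses.noInvariantsAt`).
[cite: Castella2018Erratum, Thm. 1.1 (iv), Lemma 2.1 (pp. 1–2)] -/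
theorem noInvariantsAt_of_not_split (hp3 : 3 ≤ p) (hmult : Mult W p)
    (hns : ¬ W.HasSplitMultiplicativeReductionAtPrime p) (K : Type) [Field K]
    [NumberField K] (κ : ZpExtension K p) (𝔭 : HeightOneSpectrum (𝓞 K))
    (h𝔭 : ((p : ℕ) : 𝓞 K) ∈ 𝔭.asIdeal) (he : 𝔭.asIdeal.ramificationIdx (𝓞 ℚ) = 1)
    (hf : 𝔭.asIdeal.inertiaDeg (𝓞 ℚ) = 1) (Q : (W.baseChange K).geomPrimaryTorsion p)
    (hQ : ∀ σ : absoluteGaloisGroup (𝔭.adicCompletion K),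
      GaloisRep.restrictField (𝔭.adicCompletion K) (primaryGaloisModule (W.baseChange K) p) σ Q =
        Q) : Q = 0 := by
  have h := fixedPoints_decomp_inf_kerSubgroup_eq_bot_of_not_split W p hp3 hmult hns K κ 𝔭 h𝔭 he hf
  have hmem : Q ∈ FixedPoints.addSubgroup ↥(decomp 𝔭 ⊓ κ.kerSubgroup)
      ((W.baseChange K).geomPrimaryTorsion p) := by
    refine (FixedPoints.mem_addSubgroup _ _ Q).mpr fun d ↦ ?_
    obtain ⟨σ, hσ⟩ := (mem_decomp_iff 𝔭 _).mp (Subgroup.mem_inf.mp d.2).1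
    have h1 : absGaloisRestrict K (𝔭.adicCompletion K) σ • Q = Q := hQ σ
    rw [hσ] at h1
    exact h1
  rw [h] at hmem
  exact (AddSubgroup.mem_bot).mp hmem

/-- `E(K̄)[p^∞]^{Γ_K} = 0` (X2 twin of `X11b.ErratumHypotheses.noInvariants`).
[cite: Castella2018Erratum, Thm. 1.1 (iv), Lemma 2.1 (pp. 1–2)] -/
theorem noInvariants_of_not_split (hp3 : 3 ≤ p) (hmult : Mult W p)
    (hns : ¬ W.HasSplitMultiplicativeReductionAtPrime p) (K : Type) [Field K]
    [NumberField K] (κ : ZpExtension K p) (𝔭 : HeightOneSpectrum (𝓞 K))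
    (h𝔭 : ((p : ℕ) : 𝓞 K) ∈ 𝔭.asIdeal) (he : 𝔭.asIdeal.ramificationIdx (𝓞 ℚ) = 1)
    (hf : 𝔭.asIdeal.inertiaDeg (𝓞 ℚ) = 1) (Q : (W.baseChange K).geomPrimaryTorsion p)
    (hQ : ∀ σ : absoluteGaloisGroup K, primaryGaloisModule (W.baseChange K) p σ Q = Q) : Q = 0 := by
  have h := fixedPoints_decomp_inf_kerSubgroup_eq_bot_of_not_split W p hp3 hmult hns K κ 𝔭 h𝔭 he hf
  have hmem : Q ∈ FixedPoints.addSubgroup ↥(decomp 𝔭 ⊓ κ.kerSubgroup)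
      ((W.baseChange K).geomPrimaryTorsion p) :=
    (FixedPoints.mem_addSubgroup _ _ Q).mpr fun d ↦ hQ (d : absoluteGaloisGroup K)
  rw [h] at hmem
  exact (AddSubgroup.mem_bot).mp hmem

/-- **`E(K_∞)[p^∞] = 0`, restriction-kernel form**: the restriction to `ker κ` on `E(K̄)[p^∞]`-valued
classes is injective (X2 twin of `X11b.resSubgroup_kerSubgroup_injective_of_irr_of_ram`), from
`E(K)[p] = 0` — which holds because `E(K) ↪ E(K_𝔭) = E(ℚ_p)` and `E(ℚ_p)[p] = 0`.
[cite: GreenbergLNM1716, §3 Lemma 3.1 (p. 86)] [cite: SilvermanAEC2009, Thm VII.6.1 and Exercise 3.5] -/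
theorem resSubgroup_kerSubgroup_injective_of_not_split (hp3 : 3 ≤ p) (hmult : Mult W p)
    (hns : ¬ W.HasSplitMultiplicativeReductionAtPrime p) (K : Type) [Field K] [NumberField K]
    (𝔭 : HeightOneSpectrum (𝓞 K)) (h𝔭 : ((p : ℕ) : 𝓞 K) ∈ 𝔭.asIdeal)
    (he : 𝔭.asIdeal.ramificationIdx (𝓞 ℚ) = 1) (hf : 𝔭.asIdeal.inertiaDeg (𝓞 ℚ) = 1)
    (κ : ZpExtension K p) :
    Function.Injective
      (ResKernel.resSubgroup κ.kerSubgroup ((W.baseChange K).geomPrimaryTorsion p)) := by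
  obtain ⟨γ, hγ⟩ := κ.surjective (Multiplicative.ofAdd 1)
  haveI : (W.baseChange K).IsElliptic := by rw [baseChange]; infer_instance
  refine resSubgroup_kerSubgroup_injective_of_fixedPoints_eq_bot (W.baseChange K) p κ hγ
    ((W.baseChange K).fixedPoints_kerSubgroup_geomPrimaryTorsion_eq_bot κ fun P hP ↦ ?_)
  have hfinj : Function.Injective
      (Affine.Point.map (W' := W) (embAt K p 𝔭 h𝔭 he hf).toRatAlgHom :
        (W.baseChange K).toAffine.Point →+ (W.baseChange ℚ_[p]).toAffine.Point) :=
    Affine.Point.map_injective (W' := W) (embAt K p 𝔭 h𝔭 he hf).toRatAlgHom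
  refine (injective_iff_map_eq_zero _).mp hfinj P
    (LocalTorsion.localTorsion_eq_zero_of_nonsplit W p hp3 hmult hns _ ?_)
  rw [← map_nsmul, hP, map_zero]

/-- **The `Σ(N⁺)`-relaxed control map is BIJECTIVE on X2 ∩ {non-split} data** (X2 twin of
`X11b.ErratumHypotheses.controlMap_bijective_nPlus`): `K` imaginary quadratic, `κ` anticyclotomic with
topological generator `γ`, `𝔭 ∣ p` of degree one. [cite: JetchevSkinnerWan2017, §3.3 and Thm. 3.3.1 (shape only)]
[cite: GreenbergLNM1716, §3 pp. 85–90] -/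
theorem controlMap_bijective_nPlus_of_not_split (hp3 : 3 ≤ p) (hmult : Mult W p)
    (hns : ¬ W.HasSplitMultiplicativeReductionAtPrime p) {K : Type} [Field K] [NumberField K]
    (hK : IsImaginaryQuadratic K) {κ : ZpExtension K p} (hκ : κ.IsAnticyclotomic)
    {γ : absoluteGaloisGroup K} (hγ : κ.IsTopGenerator γ) (𝔭 : HeightOneSpectrum (𝓞 K))
    (h𝔭 : ((p : ℕ) : 𝓞 K) ∈ 𝔭.asIdeal) (he : 𝔭.asIdeal.ramificationIdx (𝓞 ℚ) = 1)
    (hf : 𝔭.asIdeal.inertiaDeg (𝓞 ℚ) = 1) :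
    Function.Bijective (controlMap (W.baseChange K) p κ 𝔭 (nPlusPlaces W K p) γ) := by
  haveI : IsTotallyComplex K := hK.2
  exact IsAnticyclotomic.controlMap_bijective_of_splitBad_subset (W.baseChange K) p κ 𝔭
    (nPlusPlaces W K p) hK.1 hκ hγ
    (resSubgroup_kerSubgroup_injective_of_not_split W p hp3 hmult hns K 𝔭 h𝔭 he hf κ)
    (fixedPoints_decomp_inf_kerSubgroup_eq_bot_of_not_split W p hp3 hmult hns K κ 𝔭 h𝔭 he hf)
    (fun v hpv hbad he1 hf1 ↦ mem_nPlusPlaces_of v hpv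
      (primesEquiv_under_dvd_conductorNorm_of_not_hasGoodReductionAt K v hbad) he1 hf1)

/-! ### Atoms (L10) and (P9) -/

/-- **(L10) on X2 ∩ {non-split} data** (JSW17 Lemma 3.3.3; X2 twin of
`X11b.coinvariantsTrivialAt_of_erratum`): `K` imaginary quadratic with `p` split, `κ` with topological
generator `γ`, `𝔭 ∣ p` of degree one, `Sel_v(K, E[p^∞])` finite at every `v ∣ p` ⟹
`CoinvariantsTrivialAt (W_K) p κ 𝔭 γ` — GIVEN the four cited cohomological facts.
[cite: JetchevSkinnerWan2017, Lemma 3.3.3 (arXiv:1512.06894 pp. 11–12)] -/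
theorem coinvariantsTrivialAt_of_not_split (hp3 : 3 ≤ p) (hmult : Mult W p)
    (hns : ¬ W.HasSplitMultiplicativeReductionAtPrime p) {K : Type} [Field K]
    [NumberField K] (hPT : poitouTate_selmerStructure_duality K) (hPT2 : poitouTate_sha_tateDual K)
    (hEP : ∀ v : HeightOneSpectrum (𝓞 K), localEulerPoincareCharacteristic (v.adicCompletion K))
    (hcd : fieldCdLE_two_of_numberField) (hK : IsImaginaryQuadratic K) (hsplit : SplitsIn K p)
    (κ : ZpExtension K p) {γ : absoluteGaloisGroup K} (hγ : κ.IsTopGenerator γ)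
    {𝔭 : HeightOneSpectrum (𝓞 K)} (h𝔭 : ((p : ℕ) : 𝓞 K) ∈ 𝔭.asIdeal)
    (he : 𝔭.asIdeal.ramificationIdx (𝓞 ℚ) = 1) (hf : 𝔭.asIdeal.inertiaDeg (𝓞 ℚ) = 1)
    (hfin : ∀ v : HeightOneSpectrum (𝓞 K), ((p : ℕ) : 𝓞 K) ∈ v.asIdeal →
      Finite (selmerAcBase (W.baseChange K) p v ∅)) :
    CoinvariantsTrivialAt (W.baseChange K) p κ 𝔭 γ := by
  haveI : IsTotallyComplex K := hK.2
  obtain ⟨σ, 𝔮, -, hne, h𝔮, -⟩ :=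
    LocalIndexTransport.exists_conj_prime_of_splitsIn K p hK.1 hsplit h𝔭
  have hΓ𝔭 := noInvariantsAt_of_not_split W p hp3 hmult hns K κ 𝔭 h𝔭 he hf
  have hΓ := Coinv.noInvariants_of_noInvariants_at (W.baseChange K) p hΓ𝔭
  have htor := exists_pow_nsmul_local_eq_zero W p hK.1 hsplit
  haveI := hfin 𝔭 h𝔭
  have h2 := WeakLeopoldt.subsingleton_galoisCohomology_two_primary (W.baseChange K) p 𝔭 ∅ hPT2
    (fieldCdLE_two_of_isTotallyComplex hcd K p) hΓ htor
  exact Coinv.coinvariantsTrivialAt_of_subsingleton (W.baseChange K) p κ hPT hEP h𝔭 h𝔮 hne hΓ𝔭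
    (hfin 𝔮 h𝔮) h2 hγ

/-- **(P9) on X2 ∩ {non-split} data, from finiteness at the conjugate prime** (JSW17 Prop. 3.3.2; X2
twin of `X11b.locSurjAt_of_finite_conj`): `LocSurjAt (W_K) p 𝔭 Σ(N⁺)` — GIVEN the cited Poitou–Tate
duality for `K` and Milne I 2.8 at the completions of `K`. [cite: JetchevSkinnerWan2017, Prop. 3.3.2 (arXiv:1512.06894 p. 11)] -/
theorem locSurjAt_of_finite_conj_of_not_split (hp3 : 3 ≤ p) (hmult : Mult W p)
    (hns : ¬ W.HasSplitMultiplicativeReductionAtPrime p) {K : Type} [Field K]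
    [NumberField K] (hPT : poitouTate_selmerStructure_duality K)
    (hEP : ∀ v : HeightOneSpectrum (𝓞 K), localEulerPoincareCharacteristic (v.adicCompletion K))
    (hK : IsImaginaryQuadratic K) (κ : ZpExtension K p) {𝔭 𝔮 : HeightOneSpectrum (𝓞 K)}
    (h𝔭 : ((p : ℕ) : 𝓞 K) ∈ 𝔭.asIdeal) (he : 𝔭.asIdeal.ramificationIdx (𝓞 ℚ) = 1)
    (hf : 𝔭.asIdeal.inertiaDeg (𝓞 ℚ) = 1) (h𝔮 : ((p : ℕ) : 𝓞 K) ∈ 𝔮.asIdeal) (hne : 𝔮 ≠ 𝔭)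
    (hfin : Finite (selmerAcBase (W.baseChange K) p 𝔮 ∅)) :
    LocSurjAt (W.baseChange K) p 𝔭 (nPlusPlaces_finite (W := W) (p := p) hK.1) := by
  haveI : IsTotallyComplex K := hK.2
  haveI := hfin
  have hfin0 : Finite (acStructure (primaryGaloisModule (W.baseChange K) p) p 𝔮
      (∅ : Set (HeightOneSpectrum (𝓞 K)))).selmerGroup := by
    refine Nat.finite_of_card_ne_zero ?_
    rw [← natCard_selmerAcBase_eq_natCard_selmerGroup (W.baseChange K) p 𝔮 ∅]
    exact Nat.card_pos.ne'
  have hfinR : Finite (acStructure (primaryGaloisModule (W.baseChange K) p) p 𝔮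
      {v | (Sum.inr v : Place K) ∈ exceptionalPlaces W K p hK.1 ∧
        ((p : ℕ) : 𝓞 K) ∉ v.asIdeal}).selmerGroup :=
    finite_selmerGroup_acStructure_of_finite_empty _ p 𝔮 _ (finite_relaxationSet hK.1) hfin0
      fun v hv _ ↦ finite_galoisCohomology_one_primary_toLocal (W.baseChange K) p v (hEP v) hv.2
  exact locSurjAt_of_finite (W.baseChange K) p 𝔭 (exceptionalPlaces W K p hK.1) hPT
    (fun w ↦ IsTotallyComplex.isComplex w)
    (fun Q hQ ↦ noInvariants_of_not_split W p hp3 hmult hns K κ 𝔭 h𝔭 he hf Q hQ) h𝔭 h𝔮 hne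
    (nPlusPlaces_finite (W := W) (p := p) hK.1) (fun v hv ↦ hv.1)
    (inl_mem_exceptionalPlaces hK.1) (fun v hv ↦ inr_mem_exceptionalPlaces_of_mem hK.1 hv)
    (fun v hv ↦ inr_mem_exceptionalPlaces_of_mem_nPlusPlaces hK.1 hv)
    (fun v hv ↦ inr_mem_exceptionalPlaces_of_not_hasGoodReductionAt hK.1 hv) hfinR

/-! ### `rank E(K) = 1`, `#Ш(E/K) < ∞` for a CGLS field -/

omit [W.IsGloballyMinimal] in
/-- **At a rank-one pair and a quadratic `K` with `L(E^{(d_K)},1) ≠ 0`: `rank E(K) = 1` and `Ш(E/K)`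
is finite** (Gross–Zagier–Kolyvagin over `ℚ` for `E` and for the twist, modularity; X2 twin of
`X11b.IsErratumField.mordellWeilRank_eq_one_and_shaFinite`).
[cite: JetchevSkinnerWan2017, §7.4.1 (arXiv:1512.06894 p. 30)] [cite: DokchitserDokchitserAnnals2010, Lemma 4.14 (proof)] -/
theorem mordellWeilRank_eq_one_and_shaFinite_of_twist
    (hGZK : rank_eq_analyticRank_of_analyticRank_le_one) (hnf : exists_isNewformOf)
    (hr : W.analyticRank = 1) {K : Type} [Field K] [NumberField K] (h2 : Module.finrank ℚ K = 2)
    (hLt : (W.quadraticTwist (NumberField.discr K : ℚ)).entireLFunction 1 ≠ 0) :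
    (W.baseChange K).mordellWeilRank = 1 ∧ (W.baseChange K).ShaFinite := by
  have hmod : hasEntireLFunction_rat := hasEntireLFunction_rat_of_exists_isNewformOf hnf
  have hD0 : (NumberField.discr K : ℚ) ≠ 0 := by exact_mod_cast NumberField.discr_ne_zero K
  haveI hEt : (W.quadraticTwist (NumberField.discr K : ℚ)).IsElliptic :=
    W.isElliptic_quadraticTwist hD0
  have hrt : (W.quadraticTwist (NumberField.discr K : ℚ)).analyticRank = 0 :=
    ((W.quadraticTwist _).analyticRank_eq_zero_iff_holds (hmod _)).2 hLt
  obtain ⟨hrankW, hShaW⟩ := hGZK W (le_of_eq hr)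
  obtain ⟨hrankt, hShat⟩ := hGZK (W.quadraticTwist (NumberField.discr K : ℚ)) (by omega)
  refine ⟨?_, ?_⟩
  · rw [mordellWeilRank_baseChange_quadratic_holds W K h2, hrankW, hr, hrankt, hrt]
  · exact shaFinite_baseChange_of_shaFinite W K h2 hShaW hShat

end Summit.BirchSwinnertonDyer.Rank1Residual.X2

end
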